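import Mathlib
import Summits.Ventures.PercRepro.TriangleCapTwoTrianglesTwoBelowC

/-!
# PercRepro — THE PAIRS INSIDE SIX VERTICES OF A `K₄⁻`-FREE GRAPH, AND `k ≥ 22` (p3, gen 36; part 54)

A `K₄⁻`-free graph has at most `4` edges on any `4` vertices; double counting over the `4`-subsets of a set `S` of at
most `6` vertices (`Σ_{Q} adjPairs(Q) = Σ_{p} #{Q ∋ p} ≥ |P_S|·C(|S| − 2, 2)`) bounds the ordered adjacent pairs inside
`S` by `20`.  Fed into the far count of TriangleCapTwoTrianglesTwoBelowB this gives the two-triangle case, the `r = 2`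
stability and the cells two below the diagonal on the `K₄⁻`-free class for every `k ≥ 22`
(`Σ deficit ≥ 2 |Sᶜ| + 2m − 20 ≥ 6k − 38 ≥ 4k + 5`), and for every `k ≥ 20` by splitting at `|T₃| ≥ 15` instead of `18`
(the envelope pays `|T₃| ≥ 15` once `k ≥ 18`, the count pays `|T₃| ≤ 14` once `k ≥ 20`).
Axioms: standard.
-/

namespace PercRepro

namespace TriangleCap

namespace C047

open Finset

variable {V : Type*} [Fintype V] [DecidableEq V]

/-- The ordered adjacent pairs inside `S`, as `adjPairs` sees them. -/
theorem filter_adjPairsAll_eq_filter_product (D : SimpleGraph V) [DecidableRel D.Adj] (S : Finset V) :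
    (adjPairsAll D).filter (fun p => p.1 ∈ S ∧ p.2 ∈ S) = (S ×ˢ S).filter (fun p => D.Adj p.1 p.2) := by
  ext p
  rw [mem_filter, mem_filter, mem_adjPairsAll, mem_product]
  tauto

omit [Fintype V] in
/-- `adjPairs D Q` for `Q ⊆ S` counts the adjacent pairs of `S` lying in `Q`. -/
theorem adjPairs_eq_sum_indicator (D : SimpleGraph V) [DecidableRel D.Adj] (S Q : Finset V) (hQ : Q ⊆ S) :
    adjPairs D Q = ∑ p ∈ (S ×ˢ S).filter (fun p => D.Adj p.1 p.2), if p.1 ∈ Q ∧ p.2 ∈ Q then 1 else 0 := by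
  unfold adjPairs
  rw [← card_filter]
  congr 1
  ext p
  simp only [mem_filter, mem_product]
  constructor
  · rintro ⟨⟨h1, h2⟩, h3⟩
    exact ⟨⟨⟨hQ h1, hQ h2⟩, h3⟩, h1, h2⟩
  · rintro ⟨⟨-, h3⟩, h1, h2⟩
    exact ⟨⟨h1, h2⟩, h3⟩

omit [Fintype V] in
/-- Double counting over the `4`-subsets. -/
theorem sum_adjPairs_powersetCard (D : SimpleGraph V) [DecidableRel D.Adj] (S : Finset V) :
    ∑ Q ∈ S.powersetCard 4, adjPairs D Q =
      ∑ p ∈ (S ×ˢ S).filter (fun p => D.Adj p.1 p.2),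
        ((S.powersetCard 4).filter (fun Q => p.1 ∈ Q ∧ p.2 ∈ Q)).card := by
  rw [sum_congr rfl (fun Q hQ => adjPairs_eq_sum_indicator D S Q (mem_powersetCard.mp hQ).1)]
  rw [sum_comm]
  apply sum_congr rfl
  intro p _
  rw [card_filter]

omit [Fintype V] in
/-- A pair of distinct vertices of `S` lies in at least `C(|S| − 2, 2)` of the `4`-subsets of `S`. -/
theorem choose_le_card_filter_powersetCard (S : Finset V) {x y : V} (hx : x ∈ S) (hy : y ∈ S) (hxy : x ≠ y) :
    (S.card - 2).choose 2 ≤ ((S.powersetCard 4).filter (fun Q => x ∈ Q ∧ y ∈ Q)).card := by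
  have hc : ((S \ {x, y}).powersetCard 2).card = (S.card - 2).choose 2 := by
    rw [card_powersetCard, card_sdiff, inter_eq_left.mpr (by
      intro z hz; rw [mem_insert, mem_singleton] at hz; rcases hz with rfl | rfl <;> assumption), card_pair hxy]
  rw [← hc]
  apply card_le_card_of_injOn (fun T => T ∪ {x, y})
  · intro T hT
    rw [mem_coe, mem_powersetCard] at hT
    rw [mem_coe, mem_filter, mem_powersetCard]
    have hdisj : Disjoint T {x, y} := by
      rw [disjoint_left]
      intro z hz hz'
      have := hT.1 hz
      rw [mem_sdiff] at this
      exact this.2 hz'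
    refine ⟨⟨?_, ?_⟩, ?_, ?_⟩
    · intro z hz
      rw [mem_union] at hz
      rcases hz with hz | hz
      · exact (mem_sdiff.mp (hT.1 hz)).1
      · rw [mem_insert, mem_singleton] at hz
        rcases hz with rfl | rfl <;> assumption
    · rw [card_union_of_disjoint hdisj, hT.2, card_pair hxy]
    · rw [mem_union, mem_insert]; exact Or.inr (Or.inl rfl)
    · rw [mem_union, mem_insert, mem_singleton]; exact Or.inr (Or.inr rfl)
  · intro T hT T' hT' h
    rw [mem_coe, mem_powersetCard] at hT hT'
    have key : ∀ U ∈ (S \ {x, y}).powersetCard 2, (U ∪ {x, y}) \ {x, y} = U := by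
      intro U hU
      rw [mem_powersetCard] at hU
      rw [union_sdiff_right, sdiff_eq_self_of_disjoint]
      rw [disjoint_left]
      intro z hz hz'
      exact (mem_sdiff.mp (hU.1 hz)).2 hz'
    have h1 := key T (mem_powersetCard.mpr hT)
    have h2 := key T' (mem_powersetCard.mpr hT')
    simp only at h
    rw [← h1, ← h2, h]

/-- **AT MOST `20` ORDERED ADJACENT PAIRS INSIDE SIX VERTICES OF A `K₄⁻`-FREE GRAPH.** -/
theorem card_pairs_in_le_twenty (D : SimpleGraph V) [DecidableRel D.Adj] (hK : K4mFree D) (S : Finset V)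
    (hS : S.card ≤ 6) : ((adjPairsAll D).filter (fun p => p.1 ∈ S ∧ p.2 ∈ S)).card ≤ 20 := by
  rw [filter_adjPairsAll_eq_filter_product]
  set PS := (S ×ˢ S).filter (fun p => D.Adj p.1 p.2) with hPS
  -- the double count
  have hdc : PS.card * (S.card - 2).choose 2 ≤ 8 * S.card.choose 4 := by
    calc PS.card * (S.card - 2).choose 2 = ∑ p ∈ PS, (S.card - 2).choose 2 := by
          rw [sum_const, smul_eq_mul]
      _ ≤ ∑ p ∈ PS, ((S.powersetCard 4).filter (fun Q => p.1 ∈ Q ∧ p.2 ∈ Q)).card := by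
          apply sum_le_sum
          intro p hp
          rw [hPS, mem_filter, mem_product] at hp
          exact choose_le_card_filter_powersetCard S hp.1.1 hp.1.2 hp.2.ne
      _ = ∑ Q ∈ S.powersetCard 4, adjPairs D Q := (sum_adjPairs_powersetCard D S).symm
      _ ≤ ∑ Q ∈ S.powersetCard 4, 8 := by
          apply sum_le_sum
          intro Q hQ
          exact hK Q (mem_powersetCard.mp hQ).2
      _ = 8 * S.card.choose 4 := by rw [sum_const, smul_eq_mul, card_powersetCard, mul_comm]
  -- the trivial bound `|S|(|S| − 1)`
  have htriv : PS.card ≤ S.card * S.card - S.card := by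
    rw [← offDiag_card]
    apply card_le_card
    intro p hp
    rw [hPS, mem_filter, mem_product] at hp
    rw [mem_offDiag]
    exact ⟨hp.1.1, hp.1.2, hp.2.ne⟩
  interval_cases h : S.card
  all_goals simp only [Nat.choose] at hdc htriv ⊢
  all_goals omega

/-- **THE TWO-TRIANGLE CASE OF THE `r = 2` STABILITY FOR `k ≥ 22`.** -/
theorem two_triangles_stability_two_of_twentytwo (D : SimpleGraph V) [DecidableRel D.Adj] (hK : K4mFree D)
    (hk : 22 ≤ Fintype.card V) (hm : 2 * Fintype.card V ≤ D.edgeFinset.card + 3) {u v w a b c : V}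
    (huv : D.Adj u v) (huw : D.Adj u w) (hvw : D.Adj v w) (hab : D.Adj a b) (hac : D.Adj a c) (hbc : D.Adj b c)
    (ha : ¬ (a = u ∨ a = v ∨ a = w)) :
    ∑ v, deg D v * deg D v + 2 * (Fintype.card V - 3) ≤ D.edgeFinset.card * Fintype.card V := by
  by_cases h18 : 18 ≤ (triangles3 D).card
  · exact stability_two_of_eighteen D hK (by omega) h18
  have hT17 : (triangles3 D).card ≤ 17 := by omega
  have hid := two_mul_sum_deg_sq_add_sum_deficit D
  have hmk : 2 * (D.edgeFinset.card * Fintype.card V) = 2 * D.edgeFinset.card * Fintype.card V := by ring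
  suffices hkey : 4 * Fintype.card V + 5 ≤ ∑ p ∈ adjPairsAll D, deficit D p by omega
  rw [sum_deficit_eq_sum_far]
  have hcount := two_mul_card_edges_add_le_sum_far_add D hK huv huw hvw hab hac hbc ha
  set S : Finset V := {u, v, w, a, b, c} with hS
  have hS6 : S.card ≤ 6 := card_le_six
  have hb1 := card_pairs_in_le_twenty D hK S hS6
  have hSc := card_compl S
  omega

/-- **TWO BELOW THE DIAGONAL, `K₄⁻`-FREE, `k ≥ 22`.** -/
theorem dense_stability_two_of_twentytwo (D : SimpleGraph V) [DecidableRel D.Adj] (hK : K4mFree D)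
    (hk : 22 ≤ Fintype.card V) (hm : 2 * Fintype.card V ≤ D.edgeFinset.card + 3)
    (hnot : ¬ ∃ A : Finset V, (∀ x y, D.Adj x y → (x ∈ A ↔ y ∉ A)) ∧ (missing D A Aᶜ).card ≤ 1) :
    ∑ v, deg D v * deg D v + 2 * (Fintype.card V - 3) ≤ D.edgeFinset.card * Fintype.card V :=
  dense_stability_two_modulo_two_triangles D hK (by omega) hm hnot
    (fun u v w a b c huv huw hvw hab hac hbc ha _ =>
      two_triangles_stability_two_of_twentytwo D hK hk hm huv huw hvw hab hac hbc ha)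

/-- **THE TWO-TRIANGLE CASE FOR `k ≥ 20`:** split at `|T₃| ≥ 15` — the envelope `6 Σ d² + (k − 6)|T₃| ≤ 6mk` pays
for `|T₃| ≥ 15` once `k ≥ 18`, the far count pays for `|T₃| ≤ 14` once `k ≥ 20`. -/
theorem two_triangles_stability_two_of_twenty (D : SimpleGraph V) [DecidableRel D.Adj] (hK : K4mFree D)
    (hk : 20 ≤ Fintype.card V) (hm : 2 * Fintype.card V ≤ D.edgeFinset.card + 3) {u v w a b c : V}
    (huv : D.Adj u v) (huw : D.Adj u w) (hvw : D.Adj v w) (hab : D.Adj a b) (hac : D.Adj a c) (hbc : D.Adj b c)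
    (ha : ¬ (a = u ∨ a = v ∨ a = w)) :
    ∑ v, deg D v * deg D v + 2 * (Fintype.card V - 3) ≤ D.edgeFinset.card * Fintype.card V := by
  by_cases h15 : 15 ≤ (triangles3 D).card
  · have h := six_mul_sum_deg_sq_add_triangles_le D hK (by omega)
    have h2 : (Fintype.card V - 6) * 15 ≤ (Fintype.card V - 6) * (triangles3 D).card :=
      Nat.mul_le_mul_left _ h15
    have hmk : 6 * (D.edgeFinset.card * Fintype.card V) = 6 * D.edgeFinset.card * Fintype.card V := by ring
    obtain ⟨k', hk'⟩ : ∃ k', Fintype.card V = k' + 6 := ⟨Fintype.card V - 6, by omega⟩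
    rw [hk'] at h h2 ⊢
    have e : k' + 6 - 6 = k' := by omega
    have e3 : k' + 6 - 3 = k' + 3 := by omega
    rw [e] at h h2
    rw [e3]
    nlinarith
  have hT14 : (triangles3 D).card ≤ 14 := by omega
  have hid := two_mul_sum_deg_sq_add_sum_deficit D
  have hmk : 2 * (D.edgeFinset.card * Fintype.card V) = 2 * D.edgeFinset.card * Fintype.card V := by ring
  suffices hkey : 4 * Fintype.card V + 2 ≤ ∑ p ∈ adjPairsAll D, deficit D p by omega
  rw [sum_deficit_eq_sum_far]
  have hcount := two_mul_card_edges_add_le_sum_far_add D hK huv huw hvw hab hac hbc ha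
  set S : Finset V := {u, v, w, a, b, c} with hS
  have hS6 : S.card ≤ 6 := card_le_six
  have hb1 := card_pairs_in_le_twenty D hK S hS6
  have hSc := card_compl S
  omega

/-- **TWO BELOW THE DIAGONAL, `K₄⁻`-FREE, `k ≥ 20`.** -/
theorem dense_stability_two_of_twenty (D : SimpleGraph V) [DecidableRel D.Adj] (hK : K4mFree D)
    (hk : 20 ≤ Fintype.card V) (hm : 2 * Fintype.card V ≤ D.edgeFinset.card + 3)
    (hnot : ¬ ∃ A : Finset V, (∀ x y, D.Adj x y → (x ∈ A ↔ y ∉ A)) ∧ (missing D A Aᶜ).card ≤ 1) :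
    ∑ v, deg D v * deg D v + 2 * (Fintype.card V - 3) ≤ D.edgeFinset.card * Fintype.card V :=
  dense_stability_two_modulo_two_triangles D hK (by omega) hm hnot
    (fun u v w a b c huv huw hvw hab hac hbc ha _ =>
      two_triangles_stability_two_of_twenty D hK hk hm huv huw hvw hab hac hbc ha)

/-- **TWO BELOW THE DIAGONAL IS EXACT ON THE `K₄⁻`-FREE CLASS FOR EVERY `k ≥ 20`.** -/
theorem two_below_diagonal_exact_k4m_of_twenty (k a : ℕ) (hk : 20 ≤ k) (ha : 1 ≤ a) (hak : a + 2 ≤ k)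
    (hdense : 2 * k ≤ a * (k - a) - 2 + 3)
    (hm : ∀ a', a' ≤ k → a * (k - a) - 2 ≠ a' * (k - a') ∧ a * (k - a) - 1 ≠ a' * (k - a')) :
    (∀ (D : SimpleGraph (Fin k)) [DecidableRel D.Adj], K4mFree D →
        D.edgeFinset.card = a * (k - a) - 2 →
        2 * cherries D + 2 * (k - 3) ≤ (a * (k - a) - 2) * (k - 2)) ∧
      ∃ (D : SimpleGraph (Fin k)) (_ : DecidableRel D.Adj), K4mFree D ∧
        D.edgeFinset.card = a * (k - a) - 2 ∧ 2 * cherries D + 2 * (k - 3) = (a * (k - a) - 2) * (k - 2) := by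
  have hka : 2 ≤ a * (k - a) := by
    obtain ⟨c, hc⟩ : ∃ c, k = a + 2 + c := ⟨k - a - 2, by omega⟩
    subst hc
    have : a + 2 + c - a = 2 + c := by omega
    rw [this]
    nlinarith
  obtain ⟨m, hmm⟩ : ∃ m, a * (k - a) = m + 2 := ⟨a * (k - a) - 2, by omega⟩
  have e1 : a * (k - a) - 2 = m := by omega
  have e2 : a * (k - a) - 1 = m + 1 := by omega
  rw [e1] at hdense hm ⊢
  rw [e2] at hm
  constructor
  · intro D _ hK hD
    have hcard : Fintype.card (Fin k) = k := Fintype.card_fin k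
    have hnot : ¬ ∃ A : Finset (Fin k), (∀ x y, D.Adj x y → (x ∈ A ↔ y ∉ A)) ∧ (missing D A Aᶜ).card ≤ 1 := by
      rintro ⟨A, hA, hN⟩
      have hNX := card_missing_add_card_edges D A hA
      have hXc : Aᶜ.card = k - A.card := by
        have := card_add_card_compl A
        rw [hcard] at this
        omega
      have hXk : A.card ≤ k := by
        have := card_le_univ A
        rwa [hcard] at this
      obtain ⟨h1, h2⟩ := hm A.card hXk
      rw [hXc, hD] at hNX
      have : (missing D A Aᶜ).card = 0 ∨ (missing D A Aᶜ).card = 1 := by omega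
      rcases this with h | h
      · rw [h] at hNX; exact h1 (by omega)
      · rw [h] at hNX; exact h2 (by omega)
    have h1 := dense_stability_two_of_twenty D hK (by rw [hcard]; exact hk) (by rw [hcard, hD]; exact hdense) hnot
    have h2 := two_mul_cherries_add D
    have h3 := sum_deg_eq D
    rw [hcard, hD] at h1
    obtain ⟨k', hk'⟩ : ∃ k', k = k' + 3 := ⟨k - 3, by omega⟩
    subst hk'
    have e3 : k' + 3 - 3 = k' := by omega
    have e4 : k' + 3 - 2 = k' + 1 := by omega
    rw [e3] at h1 ⊢
    rw [e4]
    rw [hD] at h3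
    nlinarith
  · refine ⟨bipMinusStar k a 2, inferInstance, k4mFree_bipMinusStar k a 2, ?_, ?_⟩
    · have := card_edges_bipMinusStar k a 2 ha hak
      omega
    · have h := two_mul_cherries_bipMinusStar k a 2 ha hak (by omega)
      rw [hmm] at h
      obtain ⟨k', hk'⟩ : ∃ k', k = k' + 3 := ⟨k - 3, by omega⟩
      subst hk'
      have e3 : k' + 3 - 3 = k' := by omega
      have e4 : k' + 3 - 2 = k' + 1 := by omega
      have e5 : 2 * (k' + 3) - 2 - 3 = 2 * k' + 1 := by omega
      rw [e4, e5] at h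
      rw [e3, e4]
      nlinarith

/-- The cell `(22, 55)` on `K₄⁻`-free graphs (`55 = 3·19 − 2`; `55, 56` are not products `a′(22 − a′)`):
`2·cherries ≤ 1062`, attained. -/
theorem cell_twentytwo_fiftyfive_k4m :
    (∀ (D : SimpleGraph (Fin 22)) [DecidableRel D.Adj], K4mFree D → D.edgeFinset.card = 55 →
      2 * cherries D ≤ 1062) ∧
    ∃ (D : SimpleGraph (Fin 22)) (_ : DecidableRel D.Adj), K4mFree D ∧ D.edgeFinset.card = 55 ∧
      2 * cherries D = 1062 := by
  have h := two_below_diagonal_exact_k4m_of_twenty 22 3 (by norm_num) (by norm_num) (by norm_num) (by norm_num)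
    (by decide)
  have e1 : 3 * (22 - 3) - 2 = 55 := by norm_num
  have e2 : (3 * (22 - 3) - 2) * (22 - 2) = 1100 := by norm_num
  have e3 : 2 * (22 - 3) = 38 := by norm_num
  rw [e1, e2, e3] at h
  obtain ⟨h1, D, inst, h2, h3, h4⟩ := h
  exact ⟨fun D _ hK hD => by have := h1 D hK hD; omega, D, inst, h2, h3, by omega⟩


/-- The cell `(20, 49)` on `K₄⁻`-free graphs (`49 = 3·17 − 2`; `49, 50` are not products `a′(20 − a′)`):
`2·cherries ≤ 848`, attained. -/
theorem cell_twenty_fortynine_k4m :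
    (∀ (D : SimpleGraph (Fin 20)) [DecidableRel D.Adj], K4mFree D → D.edgeFinset.card = 49 →
      2 * cherries D ≤ 848) ∧
    ∃ (D : SimpleGraph (Fin 20)) (_ : DecidableRel D.Adj), K4mFree D ∧ D.edgeFinset.card = 49 ∧
      2 * cherries D = 848 := by
  have h := two_below_diagonal_exact_k4m_of_twenty 20 3 (by norm_num) (by norm_num) (by norm_num) (by norm_num)
    (by decide)
  have e1 : 3 * (20 - 3) - 2 = 49 := by norm_num
  have e2 : (3 * (20 - 3) - 2) * (20 - 2) = 882 := by norm_num
  have e3 : 2 * (20 - 3) = 34 := by norm_num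
  rw [e1, e2, e3] at h
  obtain ⟨h1, D, inst, h2, h3, h4⟩ := h
  exact ⟨fun D _ hK hD => by have := h1 D hK hD; omega, D, inst, h2, h3, by omega⟩

/-- **VERTEX-DISJOINT TRIANGLES PAY FOR `k ≥ 14`:** no hanging pairs, so `Σ deficit ≥ 4 |Sᶜ| + 2m − 20 ≥ 8k − 50`. -/
theorem two_triangles_stability_two_of_disjoint (D : SimpleGraph V) [DecidableRel D.Adj] (hK : K4mFree D)
    (hk : 14 ≤ Fintype.card V) (hm : 2 * Fintype.card V ≤ D.edgeFinset.card + 3) {u v w a b c : V}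
    (huv : D.Adj u v) (huw : D.Adj u w) (hvw : D.Adj v w) (hab : D.Adj a b) (hac : D.Adj a c) (hbc : D.Adj b c)
    (ha : ¬ (a = u ∨ a = v ∨ a = w)) (hdisj : ∀ t, (t = u ∨ t = v ∨ t = w) → ¬ (t = a ∨ t = b ∨ t = c)) :
    ∑ v, deg D v * deg D v + 2 * (Fintype.card V - 3) ≤ D.edgeFinset.card * Fintype.card V := by
  by_cases h18 : 18 ≤ (triangles3 D).card
  · exact stability_two_of_eighteen D hK (by omega) h18
  have hT17 : (triangles3 D).card ≤ 17 := by omega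
  have hid := two_mul_sum_deg_sq_add_sum_deficit D
  have hmk : 2 * (D.edgeFinset.card * Fintype.card V) = 2 * D.edgeFinset.card * Fintype.card V := by ring
  suffices hkey : 4 * Fintype.card V + 5 ≤ ∑ p ∈ adjPairsAll D, deficit D p by omega
  rw [sum_deficit_eq_sum_far]
  have hcount := two_mul_card_edges_add_four_mul_le_of_disjoint D hK huv huw hvw hab hac hbc ha hdisj
  set S : Finset V := {u, v, w, a, b, c} with hS
  have hS6 : S.card ≤ 6 := card_le_six
  have hb1 := card_pairs_in_le_twenty D hK S hS6
  have hSc := card_compl S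
  omega

end C047

end TriangleCap

end PercRepro
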